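import Literature.Analysis.FluidPDE.Wei2016PoloidalCurl
import Literature.Analysis.FluidPDE.NSWeakStrongUniquenessProofs
import Literature.Analysis.FluidPDE.TaoEnstrophyLocalisationProofs
import Literature.Analysis.FluidPDE.LerayHopfH1Test
import Literature.Analysis.FluidPDE.WholeSpaceIBP
import HarnessLib

/-!
# `‖v‖_{L⁴} ≤ ‖v^θ‖_{L⁴} + (2‖v‖_{L²})^{1/4} (K ‖ω^θ‖_{L²})^{3/4}` for axisymmetric divergence-free fields

Analysis/FluidPDE proof file (theorems only; no definitions, no named facts) on the way to
`Literature.Analysis.FluidPDE.Wei2016_logModulus_regularity`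
(`LeiZhang2017AxisymmetricCriteria.lean`): the last, purely spatial step of the a-priori
regularity argument of Wei 2016, Thm. 1.1 / Lei–Zhang 2017, §3 (arXiv:1505.02628, p. 9):

> "`∇(vʳe_r + v^ze_z) ∈ L∞L²` … by Sobolev imbedding theorem … `b = vʳe_r + v^ze_z ∈ L^∞_tL⁶_x`.
> We also have `b ∈ L∞L²` by the basic energy estimate, therefore, `b ∈ L^∞_tL⁴_x` by
> interpolation, which, together with the fact that `v^θ ∈ L∞L⁴`, gives that `v ∈ L∞L⁴`."

With the smooth poloidal field `b = v − ΦJ` of `Wei2016PoloidalCurl` (`|curl b|² = r²Ω²`,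
`div b = 0`, `|b| ≤ 2|v|`, `|ΦJ|⁴ = (x₀² + x₁²)²Φ⁴`):

* `Wei2016.eLpNorm_four_le_of_isAxisymmetric` — for `v ∈ C⁴ ∩ L²` axisymmetric divergence free,
  `‖v‖₄ ≤ (∫ (x₀²+x₁²)²Φ⁴)^{1/4} + (2‖v‖₂)^{1/4} (K (∫ (x₀²+x₁²)Ω²)^{1/2})^{3/4}` in `ℝ≥0∞`,
  `K` Mathlib's Gagliardo–Nirenberg–Sobolev constant (`div`–`curl`:
  `lintegral_frobeniusNormSq_fderiv_le_lintegral_sq_norm_curl`; Sobolev: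
  `eLpNorm_six_le_frobenius_of_hasWeakGradient`; interpolation:
  `eLpNorm_le_eLpNorm_two_rpow_mul_eLpNorm_six_rpow`);
* `Wei2016.eLpNorm_four_le_ofReal` — the same with real bounds `∫(x₀²+x₁²)²Φ⁴ ≤ M₄`,
  `∫(x₀²+x₁²)Ω² ≤ M_ω`, `‖v‖₂ ≤ M₂`: `‖v‖₄ ≤ ofReal (M₄^{1/4} + (2M₂)^{1/4}(K M_ω^{1/2})^{3/4})`.

## References

* Z. Lei, Q. S. Zhang, arXiv:1505.02628, §3 p. 9. [LeiZhang2017]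
* D. Wei, arXiv:1508.03318, end of the proof of Thm. 1.1. [Wei2016]
-/

noncomputable section

open MeasureTheory Set Function Filter Topology InnerProductSpace
open scoped RealInnerProductSpace ContDiff ENNReal NNReal

namespace Literature.Analysis.FluidPDE

namespace Wei2016

variable {u : EuclideanSpace ℝ (Fin 3) → EuclideanSpace ℝ (Fin 3)}

set_option maxHeartbeats 800000 in
/-- **`‖v‖₄ ≤ ‖v^θ‖₄ + (2‖v‖₂)^{1/4} (K ‖ω^θ‖₂)^{3/4}`** for `v ∈ C⁴ ∩ L²` axisymmetric and
divergence free, in `ℝ≥0∞` with `‖v^θ‖₄⁴ = ∫ (x₀²+x₁²)²Φ⁴` and `‖ω^θ‖₂² = ∫ (x₀²+x₁²)Ω²`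
(`Φ = angVelQuot v`, `Ω = angVortQuot v`), `K = SNormLESNormFDerivOfEqConst ℝ³ volume 2`.
[cite: LeiZhang2017, §3 p. 9] -/
theorem eLpNorm_four_le_of_isAxisymmetric (hax : IsAxisymmetric u) (hu : ContDiff ℝ 4 u)
    (hdiv : VectorCalculus.IsDivFree u) (hu2 : MemLp u 2 volume) :
    eLpNorm u 4 volume ≤
      (∫⁻ x : EuclideanSpace ℝ (Fin 3), ENNReal.ofReal ((x 0 ^ 2 + x 1 ^ 2) ^ 2 * angVelQuot u x ^ 4)) ^ (1 / 4 : ℝ) +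
        (2 * eLpNorm u 2 volume) ^ (1 / 4 : ℝ) *
          ((SNormLESNormFDerivOfEqConst (EuclideanSpace ℝ (Fin 3)) (volume : Measure (EuclideanSpace ℝ (Fin 3))) 2 : ℝ≥0∞) *
            (∫⁻ x : EuclideanSpace ℝ (Fin 3), ENNReal.ofReal ((x 0 ^ 2 + x 1 ^ 2) * angVortQuot u x ^ 2)) ^ (1 / 2 : ℝ)) ^
              (3 / 4 : ℝ) := by
  have hu2' : ContDiff ℝ 2 u := hu.of_le (by norm_num)
  have hu3 : ContDiff ℝ 3 u := hu.of_le (by norm_num)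
  have hΦ2 : ContDiff ℝ 2 (angVelQuot u) := contDiff_angVelQuot (n := 2) hu
  have hJ : ContDiff ℝ 2 (rotGen : EuclideanSpace ℝ (Fin 3) → EuclideanSpace ℝ (Fin 3)) := by
    have : (rotGen : EuclideanSpace ℝ (Fin 3) → EuclideanSpace ℝ (Fin 3)) = ⇑rotGenL := by
      funext v; rfl
    rw [this]; exact rotGenL.contDiff
  set w : EuclideanSpace ℝ (Fin 3) → EuclideanSpace ℝ (Fin 3) := fun y => angVelQuot u y • rotGen y with hw
  set b : EuclideanSpace ℝ (Fin 3) → EuclideanSpace ℝ (Fin 3) := fun y => u y - angVelQuot u y • rotGen y with hb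
  have hwc : ContDiff ℝ 2 w := hΦ2.smul hJ
  have hb2 : ContDiff ℝ 2 b := hu2'.sub hwc
  have hb1 : ContDiff ℝ 1 b := hb2.of_le (by norm_num)
  have hwm : AEStronglyMeasurable w volume := hwc.continuous.aestronglyMeasurable
  have hbm : AEStronglyMeasurable b volume := hb2.continuous.aestronglyMeasurable
  -- `u = w + b`
  have hsum : u = w + b := by funext y; simp [hw, hb]
  have htri : eLpNorm u 4 volume ≤ eLpNorm w 4 volume + eLpNorm b 4 volume := by
    conv_lhs => rw [hsum]
    exact eLpNorm_add_le hwm hbm (by norm_num)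
  -- the swirl part
  have hw4 : eLpNorm w 4 volume =
      (∫⁻ x : EuclideanSpace ℝ (Fin 3), ENNReal.ofReal ((x 0 ^ 2 + x 1 ^ 2) ^ 2 * angVelQuot u x ^ 4)) ^ (1 / 4 : ℝ) := by
    rw [eLpNorm_eq_lintegral_rpow_enorm_toReal (by norm_num) (by norm_num)]
    have h4 : (4 : ℝ≥0∞).toReal = 4 := by norm_num
    rw [h4]
    congr 1
    refine lintegral_congr fun x => ?_
    rw [← norm_angVelQuot_smul_rotGen_pow_four u x, ← ofReal_norm,
      ENNReal.ofReal_pow (norm_nonneg _)]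
    norm_cast
  -- the poloidal part: `L²` bound
  have hbL2 : eLpNorm b 2 volume ≤ 2 * eLpNorm u 2 volume := by
    have h := eLpNorm_mono (p := 2) (μ := volume) (f := b) (g := fun y => (2 : ℝ) • u y) fun y => by
      rw [norm_smul, Real.norm_eq_abs, abs_two]
      exact norm_sub_angVelQuot_smul_rotGen_le hax hu2' y
    refine h.trans ?_
    have : (fun y => (2 : ℝ) • u y) = (2 : ℝ) • u := rfl
    rw [this, eLpNorm_const_smul, Real.enorm_eq_ofReal zero_le_two, ENNReal.ofReal_ofNat]
  have hbmem : MemLp b 2 volume :=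
    ⟨hbm, lt_of_le_of_lt hbL2 (ENNReal.mul_lt_top (by simp) hu2.eLpNorm_lt_top)⟩
  -- the poloidal part: `L⁶` bound by `div`–`curl` and Sobolev
  have hE3 : Module.finrank ℝ (EuclideanSpace ℝ (Fin 3)) = 3 := finrank_euclideanSpace_fin
  have hbL2' : ∫⁻ x, ‖b x‖ₑ ^ 2 < ⊤ := by
    have := hbmem.eLpNorm_lt_top
    rw [eLpNorm_eq_lintegral_rpow_enorm_toReal (by norm_num) (by norm_num)] at this
    have h2 : (2 : ℝ≥0∞).toReal = 2 := by norm_num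
    rw [h2] at this
    have := ENNReal.rpow_lt_top_of_nonneg (by norm_num : (0 : ℝ) ≤ 2) (lt_top_iff_ne_top.1 this)
    rw [← ENNReal.rpow_mul] at this
    norm_num at this
    simpa using this
  have hdivb : VectorCalculus.IsDivFree b := fun y => by
    rw [hb, divergence_sub_angVelQuot_smul_rotGen hax hu3 y]; exact hdiv y
  have hcurl : ∫⁻ x, ‖curl b x‖ₑ ^ 2 =
      ∫⁻ x : EuclideanSpace ℝ (Fin 3), ENNReal.ofReal ((x 0 ^ 2 + x 1 ^ 2) * angVortQuot u x ^ 2) := by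
    refine lintegral_congr fun x => ?_
    rw [← ofReal_norm, ← ENNReal.ofReal_pow (norm_nonneg _), hb,
      norm_curl_sub_angVelQuot_smul_rotGen_sq hax hu x]
  have hb6 : eLpNorm b 6 volume ≤
      (SNormLESNormFDerivOfEqConst (EuclideanSpace ℝ (Fin 3)) (volume : Measure (EuclideanSpace ℝ (Fin 3))) 2 : ℝ≥0∞) *
        (∫⁻ x : EuclideanSpace ℝ (Fin 3), ENNReal.ofReal ((x 0 ^ 2 + x 1 ^ 2) * angVortQuot u x ^ 2)) ^ (1 / 2 : ℝ) := by
    have h1 := eLpNorm_six_le_frobenius_of_hasWeakGradient hE3 hbmem (HasWeakGradient.of_contDiff_holds hb1)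
    have h2 := lintegral_frobeniusNormSq_fderiv_le_lintegral_sq_norm_curl hb2 hdivb hbL2'
    rw [hcurl] at h2
    exact h1.trans (by gcongr)
  -- interpolation
  have hb4 : eLpNorm b 4 volume ≤ eLpNorm b 2 volume ^ (1 / 4 : ℝ) * eLpNorm b 6 volume ^ (3 / 4 : ℝ) := by
    have h := eLpNorm_le_eLpNorm_two_rpow_mul_eLpNorm_six_rpow (μ := volume) hbm (p := 4) (by norm_num) (by norm_num)
    have h4 : (4 : ℝ≥0∞).toReal = 4 := by norm_num
    rw [h4] at h
    norm_num at h
    exact h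
  calc eLpNorm u 4 volume ≤ eLpNorm w 4 volume + eLpNorm b 4 volume := htri
    _ ≤ _ := by
      rw [hw4]
      gcongr
      exact hb4.trans (by gcongr)

/-- **Real-bound form**: if `∫ (x₀²+x₁²)²Φ⁴ ≤ M₄`, `∫ (x₀²+x₁²)Ω² ≤ M_ω` (lower integrals against
`ofReal`) and `‖v‖₂ ≤ ofReal M₂`, then
`‖v‖₄ ≤ ofReal (M₄^{1/4} + (2M₂)^{1/4} (K M_ω^{1/2})^{3/4})`. [cite: LeiZhang2017, §3 p. 9] -/
theorem eLpNorm_four_le_ofReal (hax : IsAxisymmetric u) (hu : ContDiff ℝ 4 u)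
    (hdiv : VectorCalculus.IsDivFree u) (hu2 : MemLp u 2 volume)
    {M₄ Mω M₂ : ℝ} (hM₄ : 0 ≤ M₄) (hMω : 0 ≤ Mω) (hM₂ : 0 ≤ M₂)
    (h4 : ∫⁻ x : EuclideanSpace ℝ (Fin 3), ENNReal.ofReal ((x 0 ^ 2 + x 1 ^ 2) ^ 2 * angVelQuot u x ^ 4) ≤ ENNReal.ofReal M₄)
    (hω : ∫⁻ x : EuclideanSpace ℝ (Fin 3), ENNReal.ofReal ((x 0 ^ 2 + x 1 ^ 2) * angVortQuot u x ^ 2) ≤ ENNReal.ofReal Mω)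
    (h2 : eLpNorm u 2 volume ≤ ENNReal.ofReal M₂) :
    eLpNorm u 4 volume ≤ ENNReal.ofReal (M₄ ^ (1 / 4 : ℝ) + (2 * M₂) ^ (1 / 4 : ℝ) *
      ((SNormLESNormFDerivOfEqConst (EuclideanSpace ℝ (Fin 3)) (volume : Measure (EuclideanSpace ℝ (Fin 3))) 2 : ℝ) *
        Mω ^ (1 / 2 : ℝ)) ^ (3 / 4 : ℝ)) := by
  set K : ℝ≥0 := SNormLESNormFDerivOfEqConst (EuclideanSpace ℝ (Fin 3)) (volume : Measure (EuclideanSpace ℝ (Fin 3))) 2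
    with hK
  have h := eLpNorm_four_le_of_isAxisymmetric hax hu hdiv hu2
  refine h.trans ?_
  have e1 : (∫⁻ x : EuclideanSpace ℝ (Fin 3), ENNReal.ofReal ((x 0 ^ 2 + x 1 ^ 2) ^ 2 * angVelQuot u x ^ 4)) ^ (1 / 4 : ℝ) ≤
      ENNReal.ofReal (M₄ ^ (1 / 4 : ℝ)) := by
    rw [← ENNReal.ofReal_rpow_of_nonneg hM₄ (by norm_num)]
    exact ENNReal.rpow_le_rpow h4 (by norm_num)
  have e2 : (2 * eLpNorm u 2 volume) ^ (1 / 4 : ℝ) ≤ ENNReal.ofReal ((2 * M₂) ^ (1 / 4 : ℝ)) := by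
    rw [← ENNReal.ofReal_rpow_of_nonneg (by positivity) (by norm_num), ENNReal.ofReal_mul zero_le_two,
      ENNReal.ofReal_ofNat]
    exact ENNReal.rpow_le_rpow (by gcongr) (by norm_num)
  have e3 : ((K : ℝ≥0∞) * (∫⁻ x : EuclideanSpace ℝ (Fin 3), ENNReal.ofReal ((x 0 ^ 2 + x 1 ^ 2) * angVortQuot u x ^ 2)) ^
      (1 / 2 : ℝ)) ^ (3 / 4 : ℝ) ≤ ENNReal.ofReal (((K : ℝ) * Mω ^ (1 / 2 : ℝ)) ^ (3 / 4 : ℝ)) := by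
    rw [← ENNReal.ofReal_rpow_of_nonneg (by positivity) (by norm_num),
      ENNReal.ofReal_mul (by positivity), ← ENNReal.ofReal_rpow_of_nonneg hMω (by norm_num)]
    have hKe : ENNReal.ofReal (K : ℝ) = (K : ℝ≥0∞) := by
      rw [ENNReal.ofReal_coe_nnreal]
    rw [hKe]
    exact ENNReal.rpow_le_rpow (by gcongr) (by norm_num)
  calc _ ≤ ENNReal.ofReal (M₄ ^ (1 / 4 : ℝ)) + ENNReal.ofReal ((2 * M₂) ^ (1 / 4 : ℝ)) *
        ENNReal.ofReal (((K : ℝ) * Mω ^ (1 / 2 : ℝ)) ^ (3 / 4 : ℝ)) := by gcongr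
    _ = _ := by
      rw [← ENNReal.ofReal_mul (by positivity), ← ENNReal.ofReal_add (by positivity) (by positivity)]

end Wei2016

end Literature.Analysis.FluidPDE

end
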